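import Literature.NumberTheory.Automorphic.NewformAdelisationLift
import Literature.NumberTheory.Automorphic.NewformAdelisationHeckeLocal
import Literature.NumberTheory.Automorphic.NewformAdelisationHeckeCosets
import Literature.NumberTheory.Automorphic.NewformAdelisationHeckeClassical
import Literature.NumberTheory.Automorphic.AutomorphicTwistSatake
import Literature.NumberTheory.Automorphic.LanglandsTunnellLSeriesProofs
import HarnessLib

/-!
# Adelisation of classical modular forms, IV-c: the Hecke eigenvalues of `φ_f` (Gelbart, Lemma 3.7)

Topic `NumberTheory/Automorphic`; the last layer of the discharge plan of the adelisation
statement `Literature.NumberTheory.Automorphic.Gelbart1975_exists_adelicNewform`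
(`Sweep1SymmetricPowerAdelic`, lang.S24). It discharges the named fact
`Literature.NumberTheory.Automorphic.adelicLift_heckeEigenvalues` of `NewformAdelisationLift`
(`adelicLift_heckeEigenvalues_holds`): for a newform `f ∈ S_k(Γ₁(N))` with `T_p f = a_p f`,
nebentypus `χ`, and a finite place `v = p ∤ N`, the `L²`-class of the adelic lift `φ_f`
(`adelicLift N k f`) satisfies, at the level `K(N)` and for the uniformizer `ϖ = p ∈ ℚ_pˣ`
(`Rat.localUniformizer`),
`[K(N) diag(ϖ,1) K(N)] [φ_f] = p^{1-k/2} a_p [φ_f]` and `[K(N) diag(ϖ,ϖ) K(N)] [φ_f] = χ(p) [φ_f]`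
— Gelbart (1975), Lemma 3.7 (`p^{k/2-1} T̃(p) φ_f = φ_{T(p)f}`) and Bump (1997), §3.6, p. 342
(`𝕋_p φ = λ_p φ`, `ℝ_p φ = χ(p) φ`).

The proof is the printed one (Gelbart, pp. 31–32; Bump, pp. 341–342), assembled from the
four earlier layers:

* `[K t K] [φ] = ∑ⱼ R(yⱼ) [φ]` for any transversal `{yⱼ}` of `K t K / K`
  (`heckeOperator_apply_eq_sum` of `HeckeAlgebra`); the transversal is the adelic image of the
  local representatives `(p j; 0 1)`, `j < p`, `(1 0; 0 p)` of `GL₂(ℤ_p) diag(p,1) GL₂(ℤ_p)`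
  (`bijOn_ofLocal_heckeLocalRep` of `NewformAdelisationHeckeLocal`, "elementary divisors");
  in `L²` the sum of the translates `x ↦ φ_f(x yⱼ)` is computed pointwise
  (`heckeOperatorAt_toLp_eq_smul_of_sum_eq`);
* for `h ∈ GL₂(𝔸_ℚ)` write `h = γ (g_∞, 1) u` with `γ ∈ GL₂(ℚ)`, `det g_∞ > 0`,
  `u ∈ {1} × K₁(N)` (strong approximation, `NewformAdelisation`); `γ` disappears by left
  invariance, and `u` permutes the cosets `yⱼ ({1} × K₁(N))` (Bump, p. 342:
  "`k₀ i_p(ξ_i) = i_p(ξ_j) k₀'`"; `sum_apply_mul_mul_eq_of_bijOn_cosets`), so it disappears by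
  right invariance (`sum_adelicLiftFun_mul_eq`);
* for `h = (g_∞, 1)`: `φ_f((g_∞,1) yⱼ) = φ_f(βⱼ⁻¹ (g_∞,1) yⱼ) = archLift k f (βⱼ⁻¹ g_∞)` for the
  rational matrices `βⱼ = (p j; 0 1)`, `β_∞ = (a b'; pN pd')` of
  `NewformAdelisationHeckeClassical`, because `βⱼ⁻¹ yⱼ` is trivial, resp. integral, at `p` and
  `βⱼ⁻¹ ∈ K₁(N)_ℓ` at every `ℓ ≠ p` (Gelbart, p. 32: "`g_∞ k₀ (p -b; 0 1) = γ' (p⁻¹ bp⁻¹; 0 1) g_∞ k₀'`";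
  the bookkeeping at `ℓ ∣ N` is `NewformAdelisationHeckeCosets`,
  `Rat.globalToLocal_mapGL_mul_scalarPrime_inv_mem_localGammaOne`), see
  `adelicLiftFun_ofRealGL_mul_eq_archLift`, `Rat.globalToLocal_heckeBeta_inv_mul_mem_localGammaOne`;
* the resulting archimedean sum is `∑ⱼ archLift k f (βⱼ⁻¹ g_∞) = p^{1-k/2} a_p archLift k f g_∞`
  (`sum_archLift_heckeBeta_inv_mul` of `NewformAdelisationHeckeClassical`: Diamond–Shurman's
  formula for `T_p` and `T_p f = a_p f`), and for the central element `diag(p,p)_p` one gets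
  `φ_f((g_∞,1) diag(p,p)_p) = archLift k f (p⁻¹ δ⁻¹ g_∞) = χ(p) archLift k f g_∞` with
  `δ⁻¹ = (d' -b'; -N a) ∈ Γ₀(N)`, `a ≡ p (N)` (Bump (6.4); `adelicLiftFun_mul_heckeDiagAt_two`).

The only external input besides the four layers is the nebentypus fact
`IsNewform1.mem_nebentypusSubspace_nebentypus` (`f ∈ S_k(N, χ)`), proved in
`LanglandsTunnellLSeriesProofs` (`IsNewform1.mem_nebentypusSubspace_nebentypus_holds`).
Everything in this file is proved; no definitions and no named facts are introduced.

## References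

* S. Gelbart, *Automorphic forms on adele groups*, Ann. of Math. Stud. 83 (1975), §3.B, (3.15),
  Lemma 3.7 and its proof, pp. 31–32 [Gelbart1975].
* D. Bump, *Automorphic forms and representations* (1997), §3.6, (6.4), (6.7), Thm. 3.6.1 and
  its proof, pp. 341–342 [Bump1997].
* F. Diamond, J. Shurman, *A first course in modular forms*, GTM 228 (2005), Prop. 5.2.1
  [DiamondShurman2005].
-/

noncomputable section

open Matrix NumberField IsDedekindDomain UpperHalfPlane MeasureTheory
open scoped MatrixGroups ModularForm NNReal ENNReal

namespace Literature.NumberTheory.Automorphic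

open EllipticCurves.ModularForms CongruenceSubgroup Rat.HeightOneSpectrum

/-! ### From pointwise identities to identities in `L²` -/

section LpSum

variable {α : Type*} {m : MeasurableSpace α} {μ : Measure α} {E : Type*} [NormedAddCommGroup E]
  {q : ℝ≥0∞}

/-- A finite sum of `Lᵖ`-classes of `Lᵖ` functions is the class of their sum. [folklore] -/
theorem finset_sum_toLp {ι : Type*} (s : Finset ι) (g : ι → α → E) (hg : ∀ i, MemLp (g i) q μ) :
    ∑ i ∈ s, (hg i).toLp (g i) = (memLp_finsetSum' s fun i _ => hg i).toLp (∑ i ∈ s, g i) := by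
  classical
  induction s using Finset.induction_on with
  | empty =>
    have h : (memLp_finsetSum' ∅ fun i _ => hg i).toLp (∑ i ∈ (∅ : Finset ι), g i) =
        (MemLp.zero : MemLp (0 : α → E) q μ).toLp 0 :=
      MemLp.toLp_congr _ _ (Filter.EventuallyEq.of_eq (by rw [Finset.sum_empty]))
    rw [h, Finset.sum_empty, MemLp.toLp_zero]
  | insert a s ha ih =>
    have h : (memLp_finsetSum' (insert a s) fun i _ => hg i).toLp (∑ i ∈ insert a s, g i) =
        ((hg a).add (memLp_finsetSum' s fun i _ => hg i)).toLp (g a + ∑ i ∈ s, g i) :=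
      MemLp.toLp_congr _ _ (Filter.EventuallyEq.of_eq (by rw [Finset.sum_insert ha]))
    rw [h, Finset.sum_insert ha, ih, MemLp.toLp_add]

end LpSum

section HilbertSpace

variable {K : Type} [Field K] [NumberField K] {𝒢 : AdelicGroupData K}
  {ν : Measure 𝒢.automorphicQuotient} [𝒢.IsAutomorphicMeasure ν]

/-- **The regular representation on the class of a function**: for `Φ ∈ ℒ²` with class
`[Φ] ∈ W`, the vector `R(y) [Φ] ∈ W` is the class of `x ↦ Φ(y⁻¹ x)` (Mathlib
`DomMulAct.mk_smul_toLp`; Borel–Jacquet (1979), §4.6). [folklore] -/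
theorem AdelicGroupData.coe_toRepresentation_apply_toLp
    (W : ContRepresentation.ClosedSubrep (𝒢.rightRegular ν)) {Φ : 𝒢.automorphicQuotient → ℂ}
    (hΦ : MemLp Φ 2 ν) (hW : hΦ.toLp Φ ∈ W) (y : 𝒢.Adelic) :
    (((W.toContRep.toRepresentation) y ⟨hΦ.toLp Φ, hW⟩ : W.toSubmodule) : 𝒢.L2 ν) =
      (hΦ.comp_measurePreserving (measurePreserving_smul y⁻¹ ν)).toLp (fun x => Φ (y⁻¹ • x)) := by
  change ((W.toContRep y ⟨hΦ.toLp Φ, hW⟩ : W.toSubmodule) : 𝒢.L2 ν) = _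
  rw [ContRepresentation.ClosedSubrep.coe_toContRep_apply, AdelicGroupData.rightRegular_apply,
    DomMulAct.mk_smul_toLp]

/-- **Sums of translates in `L²` are computed pointwise**: if `∑_{y ∈ s} Φ(y⁻¹ x) = c Φ(x)` for
every `x`, then `∑_{y ∈ s} R(y) [Φ] = c [Φ]` in any closed subrepresentation `W ∋ [Φ]`. [folklore] -/
theorem AdelicGroupData.sum_toRepresentation_apply_toLp_eq_smul
    (W : ContRepresentation.ClosedSubrep (𝒢.rightRegular ν)) {Φ : 𝒢.automorphicQuotient → ℂ}
    (hΦ : MemLp Φ 2 ν) (hW : hΦ.toLp Φ ∈ W) (s : Finset 𝒢.Adelic) (c : ℂ)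
    (hpt : ∀ x, ∑ y ∈ s, Φ (y⁻¹ • x) = c * Φ x) :
    ∑ y ∈ s, (W.toContRep.toRepresentation) y ⟨hΦ.toLp Φ, hW⟩ = c • ⟨hΦ.toLp Φ, hW⟩ := by
  apply Subtype.ext
  rw [Submodule.coe_sum, Submodule.coe_smul]
  simp_rw [AdelicGroupData.coe_toRepresentation_apply_toLp]
  rw [finset_sum_toLp s (fun y x => Φ (y⁻¹ • x))
    (fun y => hΦ.comp_measurePreserving (measurePreserving_smul y⁻¹ ν)), ← MemLp.toLp_const_smul]
  refine MemLp.toLp_congr _ _ (Filter.EventuallyEq.of_eq ?_)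
  funext x
  rw [Finset.sum_apply, Pi.smul_apply, smul_eq_mul]
  exact hpt x

/-- **Hecke operators on the class of a function, through a transversal**: if `{yᵢ}` is a
transversal of `Kf t Kf / Kf`, `[Φ] ∈ W^{Kf}` and `∑ᵢ Φ(yᵢ⁻¹ x) = c Φ(x)` pointwise, then
`[Kf t Kf] [Φ] = c [Φ]` (`heckeOperator_apply_eq_sum`; Gelbart (1975), (3.15): `T̃(p)` is the sum
of the right translates by the coset representatives). [cite: Gelbart1975, §3.B, (3.15)] -/
theorem heckeOperatorAt_toLp_eq_smul_of_sum_eq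
    (W : ContRepresentation.ClosedSubrep (𝒢.rightRegular ν)) {Φ : 𝒢.automorphicQuotient → ℂ}
    (hΦ : MemLp Φ 2 ν) (hW : hΦ.toLp Φ ∈ W) (Kf : Subgroup 𝒢.Adelic) (t : 𝒢.Adelic)
    {ι : Type*} [Fintype ι] {y : ι → 𝒢.Adelic} (hinj : Function.Injective y)
    (hs : Set.BijOn (fun x : 𝒢.Adelic => (x : 𝒢.Adelic ⧸ Kf)) (Set.range y) (MulAction.orbit Kf (t : 𝒢.Adelic ⧸ Kf)))
    (hfix : (⟨hΦ.toLp Φ, hW⟩ : W.toSubmodule) ∈ W.fixedVectors Kf) (c : ℂ)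
    (hpt : ∀ x, ∑ i, Φ ((y i)⁻¹ • x) = c * Φ x) :
    heckeOperatorAt W Kf t ⟨hΦ.toLp Φ, hW⟩ = c • ⟨hΦ.toLp Φ, hW⟩ := by
  classical
  have hs' : Set.BijOn (fun x : 𝒢.Adelic => (x : 𝒢.Adelic ⧸ Kf)) ↑(Finset.univ.image y)
      (MulAction.orbit Kf (t : 𝒢.Adelic ⧸ Kf)) := by
    rwa [Finset.coe_image, Finset.coe_univ, Set.image_univ]
  rw [heckeOperatorAt, heckeOperator_apply_eq_sum _ Kf t _ hs' hfix]
  refine AdelicGroupData.sum_toRepresentation_apply_toLp_eq_smul W hΦ hW _ c fun x => ?_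
  rw [Finset.sum_image fun i _ j _ h => hinj h]
  exact hpt x

/-- **Hecke operators of central elements on the class of a function**: for `t` central,
`[Φ] ∈ W^{Kf}` and `Φ(t⁻¹ x) = c Φ(x)` pointwise, `[Kf t Kf] [Φ] = R(t) [Φ] = c [Φ]`
(`heckeOperator_apply_of_mem_center`; Bump (1997), §3.6, p. 341: `ℝ_p`). [folklore] -/
theorem heckeOperatorAt_toLp_eq_smul_of_mem_center
    (W : ContRepresentation.ClosedSubrep (𝒢.rightRegular ν)) {Φ : 𝒢.automorphicQuotient → ℂ}
    (hΦ : MemLp Φ 2 ν) (hW : hΦ.toLp Φ ∈ W) (Kf : Subgroup 𝒢.Adelic) {t : 𝒢.Adelic}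
    (ht : t ∈ Subgroup.center 𝒢.Adelic)
    (hfix : (⟨hΦ.toLp Φ, hW⟩ : W.toSubmodule) ∈ W.fixedVectors Kf) (c : ℂ)
    (hpt : ∀ x, Φ (t⁻¹ • x) = c * Φ x) :
    heckeOperatorAt W Kf t ⟨hΦ.toLp Φ, hW⟩ = c • ⟨hΦ.toLp Φ, hW⟩ := by
  rw [heckeOperatorAt, heckeOperator_apply_of_mem_center _ Kf ht hfix]
  have h := AdelicGroupData.sum_toRepresentation_apply_toLp_eq_smul W hΦ hW {t} c
    (fun x => by rw [Finset.sum_singleton]; exact hpt x)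
  rwa [Finset.sum_singleton] at h

end HilbertSpace

/-! ### The archimedean decomposition `h = γ (g_∞, 1) u` and the value `φ_f((g_∞,1) y)` -/

section Archimedean

/-- `(g_∞, 1)` rebuilt from the archimedean part `g_∞` of `h` is `ofArch` of its first
component (`ℝ = 𝔸_{ℚ,∞}`). [folklore] -/
theorem Rat.ofRealGL_archGL (n : ℕ) (h : GL (Fin n) (AdeleRing (𝓞 ℚ) ℚ)) :
    Rat.ofRealGL n (Rat.archGL n h) = GLn.ofArch n ℚ (GLn.fstHom n ℚ h) := by
  rw [Rat.ofRealGL, MonoidHom.comp_apply]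
  congr 1
  refine Matrix.GeneralLinearGroup.ext fun i j => ?_
  rw [Matrix.GeneralLinearGroup.map_apply, Rat.archGL_apply]
  exact Rat.infiniteAdeleRingEquivReal.symm_apply_apply _

/-- An element of `GL₂(𝔸_ℚ)` with trivial first component has trivial archimedean part. [folklore] -/
theorem Rat.archGL_eq_one_of_fstHom_eq_one {n : ℕ} {u : GL (Fin n) (AdeleRing (𝓞 ℚ) ℚ)}
    (hu : GLn.fstHom n ℚ u = 1) : Rat.archGL n u = 1 := by
  rw [Rat.archGL, MonoidHom.comp_apply, hu, map_one]

/-- **`h = (h_∞, 1) · u` with `u ∈ {1} × K₁(𝔫)`** for `h ∈ GL₂(ℝ)⁺ × K₁(𝔫)`: the element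
`u = (h_∞, 1)⁻¹ h` has trivial archimedean component and the finite part of `h`
(Gelbart (1975), §3.A: `g = g_∞ k₀`). [cite: Gelbart1975, §3.A, (3.1)] -/
theorem Rat.ofRealGL_archGL_inv_mul_mem_gammaOneLevel {𝔫 : Ideal (𝓞 ℚ)}
    {h : GL (Fin 2) (AdeleRing (𝓞 ℚ) ℚ)} (hh : h ∈ Rat.plusLevelOne 𝔫) :
    (Rat.ofRealGL 2 (Rat.archGL 2 h))⁻¹ * h ∈ gammaOneLevel ℚ 𝔫 := by
  rw [mem_gammaOneLevel_iff, map_mul, map_inv, Rat.ofRealGL_archGL, GLn.fstHom_ofArch,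
    inv_mul_cancel, map_mul, map_inv, GLn.sndHom_ofArch, inv_one, one_mul]
  exact ⟨rfl, (Rat.mem_plusLevelOne_iff.1 hh).2⟩

variable {N : ℕ} [NeZero N] {k : ℤ} {F : Type*} [FunLike F ℍ ℂ]
  [SlashInvariantFormClass F (Gamma1 N) k] (f : F)

/-- **Right invariance of `φ_f` under `{1} × K₁(N)`**, membership form
(`adelicLiftFun_mul_of_archGL_eq_one`; Gelbart (1975), Prop. 3.1 (ii)). [cite: Gelbart1975, Prop. 3.1] -/
theorem adelicLiftFun_mul_of_mem_gammaOneLevel (x : GL (Fin 2) (AdeleRing (𝓞 ℚ) ℚ))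
    {u : GL (Fin 2) (AdeleRing (𝓞 ℚ) ℚ)} (hu : u ∈ gammaOneLevel ℚ (Ideal.span {(N : 𝓞 ℚ)})) :
    adelicLiftFun N k f (x * u) = adelicLiftFun N k f x := by
  rw [mem_gammaOneLevel_iff] at hu
  exact adelicLiftFun_mul_of_archGL_eq_one f (Rat.archGL_eq_one_of_fstHom_eq_one hu.1) hu.2 x

/-- **The value of `φ_f` at `(g_∞, 1) y` through a matching rational matrix** (Gelbart (1975),
proof of Lemma 3.7, p. 32: `g_∞ k₀ (p -b; 0 1) = γ' (p⁻¹ bp⁻¹; 0 1) g_∞ k₀'`; Bump (1997), p. 342):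
if `β ∈ GL₂(ℚ)` has `det β > 0`, `y ∈ GL₂(𝔸_ℚ)` has trivial archimedean part, and
`β⁻¹ y_w ∈ K₁(N)_w` at every finite place `w`, then `β⁻¹ (g_∞, 1) y ∈ GL₂(ℝ)⁺ × K₁(N)` with
archimedean part `β⁻¹ g_∞`, so `φ_f((g_∞,1) y) = φ_f(β⁻¹ (g_∞, 1) y) = archLift k f (β⁻¹ g_∞)`.
[cite: Gelbart1975, Lemma 3.7 (proof)] -/
theorem adelicLiftFun_ofRealGL_mul_eq_archLift {g : GL (Fin 2) ℝ} (hg : 0 < g.det.val)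
    {β : GL (Fin 2) ℚ} (hβ : 0 < (β.det : ℚ)) {y : GL (Fin 2) (AdeleRing (𝓞 ℚ) ℚ)}
    (hy : Rat.archGL 2 y = 1)
    (hβy : ∀ w : HeightOneSpectrum (𝓞 ℚ),
      Rat.globalToLocal 2 w β⁻¹ * GLn.localPart 2 ℚ w y ∈ Rat.localGammaOne w (Ideal.span {(N : 𝓞 ℚ)})) :
    adelicLiftFun N k f (Rat.ofRealGL 2 g * y) =
      archLift k f ((Matrix.GeneralLinearGroup.map (Rat.castHom ℝ) β)⁻¹ * g) := by
  have harch : Rat.archGL 2 ((GLn.ofGlobal 2 ℚ β)⁻¹ * (Rat.ofRealGL 2 g * y)) =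
      (Matrix.GeneralLinearGroup.map (Rat.castHom ℝ) β)⁻¹ * g := by
    rw [map_mul, map_inv, map_mul, Rat.archGL_ofGlobal, Rat.archGL_ofRealGL, hy, mul_one]
  have hmem : (GLn.ofGlobal 2 ℚ β)⁻¹ * (Rat.ofRealGL 2 g * y) ∈
      Rat.plusLevelOne (Ideal.span {(N : 𝓞 ℚ)}) := by
    rw [Rat.mem_plusLevelOne_iff_forall_toLocal, harch]
    refine ⟨?_, fun w => ?_⟩
    · rw [map_mul, map_inv, Units.val_mul, Units.val_inv_eq_inv_val,
        Matrix.GeneralLinearGroup.map_det, Units.coe_map, MonoidHom.coe_coe, Rat.coe_castHom]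
      exact mul_pos (inv_pos.2 (by exact_mod_cast hβ)) hg
    · rw [map_mul, map_inv, map_mul, GLn.localPart_ofGlobal, GLn.localPart_ofRealGL, one_mul]
      exact hβy w
  rw [adelicLiftFun_eq_archLift f hmem, harch]

end Archimedean

/-! ### The rational matrices `βⱼ` match the local representatives `yⱼ` -/

section Matching

variable {v : HeightOneSpectrum (𝓞 ℚ)} {N : ℕ}

/-- `βⱼ = T^j · diag(p, 1)` in `GL₂(ℚ)` for `j < p` (`(1 j; 0 1)(p 0; 0 1) = (p j; 0 1)`). [folklore] -/
theorem Rat.heckeBeta_some_eq {a b' d' : ℤ} (had : a * d' - b' * N = 1) (j : Fin (natGenerator v)) :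
    heckeBeta (natGenerator v) a b' d' N (prime_natGenerator v).ne_zero had (some j) =
      Matrix.SpecialLinearGroup.mapGL ℚ (ModularGroup.T ^ ((j : ℕ) : ℤ)) * Rat.diagPrime v := by
  refine Matrix.GeneralLinearGroup.ext fun i l => ?_
  have hentry : ∀ (B : SL(2, ℤ)) i l,
      ((Matrix.SpecialLinearGroup.mapGL ℚ B : GL (Fin 2) ℚ) : Matrix (Fin 2) (Fin 2) ℚ) i l =
        ((B : Matrix (Fin 2) (Fin 2) ℤ) i l : ℚ) := fun B i l => rfl
  simp only [coe_heckeBeta_some, Units.val_mul, Matrix.mul_apply, Fin.sum_univ_two, hentry,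
    ModularGroup.coe_T_zpow, Rat.coe_diagPrime]
  fin_cases i <;> fin_cases l <;> simp

/-- `diag(1, p) · diag(p, 1) = p · 1` in `GL₂(ℚ)`. [folklore] -/
theorem Rat.diagGL_one_mul_diagPrime :
    ((diagGL 1 (natGenerator v : ℚ) one_pos (Nat.cast_pos.mpr (prime_natGenerator v).pos) : GL(2, ℚ)⁺) :
        GL (Fin 2) ℚ) * Rat.diagPrime v = Rat.scalarPrime v := by
  refine Matrix.GeneralLinearGroup.ext fun i l => ?_
  rw [Units.val_mul, coe_coe_diagGL, Rat.coe_diagPrime, Rat.coe_scalarPrime, Matrix.smul_apply,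
    Matrix.one_apply]
  fin_cases i <;> fin_cases l <;> simp [Matrix.mul_apply, Fin.sum_univ_two]

/-- `p · 1` is central in `GL₂(ℚ)`. [folklore] -/
theorem Rat.scalarPrime_mul_comm (v : HeightOneSpectrum (𝓞 ℚ)) (x : GL (Fin 2) ℚ) :
    Rat.scalarPrime v * x = x * Rat.scalarPrime v := by
  refine Units.ext ?_
  rw [Units.val_mul, Units.val_mul, Rat.coe_scalarPrime, Matrix.smul_mul, Matrix.mul_smul,
    Matrix.one_mul, Matrix.mul_one]

/-- `β_∞⁻¹ = δ⁻¹ (p·1)⁻¹ diag(p, 1)` in `GL₂(ℚ)`, `δ = (a b'; N d')` (`β_∞ = diag(1,p) δ` and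
`diag(1,p) = (p·1) diag(p,1)⁻¹`). [folklore] -/
theorem Rat.heckeBeta_none_inv_eq {a b' d' : ℤ} (had : a * d' - b' * N = 1) :
    (heckeBeta (natGenerator v) a b' d' N (prime_natGenerator v).ne_zero had none)⁻¹ =
      Matrix.SpecialLinearGroup.mapGL ℚ (bezoutDelta a b' d' N had)⁻¹ * (Rat.scalarPrime v)⁻¹ *
        Rat.diagPrime v := by
  have hdiag : ((diagGL 1 (natGenerator v : ℚ) one_pos (Nat.cast_pos.mpr (prime_natGenerator v).pos) :
      GL(2, ℚ)⁺) : GL (Fin 2) ℚ) = (Rat.diagPrime v)⁻¹ * Rat.scalarPrime v := by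
    rw [← Rat.scalarPrime_mul_comm]
    exact eq_mul_inv_of_mul_eq Rat.diagGL_one_mul_diagPrime
  rw [heckeBeta_none_eq, hdiag, map_inv]
  group

/-- **At `p`, `βⱼ` is the local representative `yⱼ = (p j; 0 1)`** (`j < p`): the localisation
of `(p j; 0 1) ∈ GL₂(ℚ)` at `v = p` is `(ϖ j; 0 1)`, `ϖ = p ∈ ℚ_p` (Bump (1997), (6.7):
`i_p(ξ_i)`). [cite: Bump1997, §3.6, (6.7)] -/
theorem Rat.globalToLocal_heckeBeta_some {a b' d' : ℤ} (had : a * d' - b' * N = 1)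
    (j : Fin (natGenerator v)) :
    Rat.globalToLocal 2 v (heckeBeta (natGenerator v) a b' d' N (prime_natGenerator v).ne_zero had (some j)) =
      heckeLocalRep (Rat.localUniformizer v : v.adicCompletion ℚ)
        (fun i : Fin (natGenerator v) => algebraMap ℚ (v.adicCompletion ℚ) ((i : ℕ) : ℚ))
        (Rat.localUniformizer v).ne_zero (some j) := by
  refine Matrix.GeneralLinearGroup.ext fun i l => ?_
  rw [Rat.coe_globalToLocal_apply, coe_heckeBeta_some, coe_heckeLocalRep_some, Rat.val_localUniformizer]
  fin_cases i <;> fin_cases l <;> simp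

/-- **At `p`, `β_∞⁻¹ y_∞` is integral**: `β_∞⁻¹ (1 0; 0 ϖ) = δ⁻¹ ∈ SL₂(ℤ)` at `v = p`
(`β_∞ = diag(1,p) δ`, and `diag(1,p)` localises to `y_∞ = (1 0; 0 ϖ)`). [folklore] -/
theorem Rat.globalToLocal_heckeBeta_none_inv_mul {a b' d' : ℤ} (had : a * d' - b' * N = 1) :
    Rat.globalToLocal 2 v (heckeBeta (natGenerator v) a b' d' N (prime_natGenerator v).ne_zero had none)⁻¹ *
        heckeLocalRep (Rat.localUniformizer v : v.adicCompletion ℚ)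
          (fun i : Fin (natGenerator v) => algebraMap ℚ (v.adicCompletion ℚ) ((i : ℕ) : ℚ))
          (Rat.localUniformizer v).ne_zero none =
      (Rat.globalToLocal 2 v (Matrix.SpecialLinearGroup.mapGL ℚ (bezoutDelta a b' d' N had)))⁻¹ := by
  have hloc : Rat.globalToLocal 2 v ((diagGL 1 (natGenerator v : ℚ) one_pos
      (Nat.cast_pos.mpr (prime_natGenerator v).pos) : GL(2, ℚ)⁺) : GL (Fin 2) ℚ) =
      heckeLocalRep (Rat.localUniformizer v : v.adicCompletion ℚ)
        (fun i : Fin (natGenerator v) => algebraMap ℚ (v.adicCompletion ℚ) ((i : ℕ) : ℚ))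
        (Rat.localUniformizer v).ne_zero none := by
    refine Matrix.GeneralLinearGroup.ext fun i l => ?_
    rw [Rat.coe_globalToLocal_apply, coe_coe_diagGL, coe_heckeLocalRep_none, Rat.val_localUniformizer]
    fin_cases i <;> fin_cases l <;> simp
  rw [heckeBeta_none_eq, _root_.mul_inv_rev, map_mul, map_inv, map_inv, ← hloc, inv_mul_cancel_right]

/-- **The matching of `βⱼ` and `yⱼ` at every finite place** (the hypothesis of
`adelicLiftFun_ofRealGL_mul_eq_archLift` for Gelbart's/Bump's representatives): for `v = p ∤ N`,
`βⱼ⁻¹ (yⱼ)_w ∈ K₁(N)_w` for all `w` — at `w = v` this is `1` (`j < p`) or `δ⁻¹ ∈ SL₂(ℤ)`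
(`j = ∞`); at `w ≠ v` it is `βⱼ⁻¹ = diag(p,1)⁻¹ T^{-j}`, resp. `δ⁻¹ (p·1)⁻¹ diag(p,1)`, which lie
in `K₁(N)_w` by `Rat.globalToLocal_diagPrime_mem_localGammaOne`, `Γ₁(N) ⊆ K₁(N)_w` and
`Rat.globalToLocal_mapGL_mul_scalarPrime_inv_mem_localGammaOne` (`a ≡ p (N)`; Gelbart (1975),
(3.3)–(3.5) and p. 32; Bump (1997), (6.4)). [cite: Gelbart1975, Lemma 3.7 (proof)] -/
theorem Rat.globalToLocal_heckeBeta_inv_mul_mem_localGammaOne [NeZero N]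
    (hv : ¬ v.asIdeal ∣ Ideal.span {(N : 𝓞 ℚ)}) {a b' d' : ℤ} (had : a * d' - b' * N = 1)
    (hap : (N : ℤ) ∣ a - natGenerator v) (j : Option (Fin (natGenerator v))) (w : HeightOneSpectrum (𝓞 ℚ)) :
    Rat.globalToLocal 2 w (heckeBeta (natGenerator v) a b' d' N (prime_natGenerator v).ne_zero had j)⁻¹ *
        GLn.localPart 2 ℚ w (GLn.ofLocal 2 ℚ v
          (heckeLocalRep (Rat.localUniformizer v : v.adicCompletion ℚ)
            (fun i : Fin (natGenerator v) => algebraMap ℚ (v.adicCompletion ℚ) ((i : ℕ) : ℚ))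
            (Rat.localUniformizer v).ne_zero j)) ∈
      Rat.localGammaOne w (Ideal.span {(N : 𝓞 ℚ)}) := by
  have h𝔫 : Ideal.span {(N : 𝓞 ℚ)} ≠ 0 := Rat.span_natCast_ne_zero N
  -- the Bezout matrix `δ⁻¹ ∈ Γ₀(N)` has lower right entry `a ≡ p (mod N)`
  have hγ : CongruenceSubgroup.Gamma0Map N ⟨(bezoutDelta a b' d' N had)⁻¹, bezoutDelta_inv_mem_gamma0 a b' d' N had⟩ =
      ((natGenerator v : ℕ) : ZMod N) := by
    change (((((bezoutDelta a b' d' N had)⁻¹ : SL(2, ℤ)) : Matrix (Fin 2) (Fin 2) ℤ) 1 1 : ℤ) : ZMod N) = _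
    rw [bezoutDelta_inv_apply_one_one, ← Int.cast_natCast]
    exact ((ZMod.intCast_eq_intCast_iff_dvd_sub (natGenerator v : ℤ) a N).2 hap).symm
  by_cases hw : w = v
  · subst hw
    rw [GLn.localPart_ofLocal]
    refine Rat.valuedCongruenceSubgroup_one_le_localGammaOne h𝔫 hv ?_
    cases j with
    | some j =>
      rw [map_inv, Rat.globalToLocal_heckeBeta_some had j, inv_mul_cancel]
      exact one_mem _
    | none =>
      rw [Rat.globalToLocal_heckeBeta_none_inv_mul had]
      exact inv_mem (Rat.globalToLocal_mapGL_mem_valuedCongruenceSubgroup_one _)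
  · rw [GLn.localPart_ofLocal_of_ne hw, mul_one]
    cases j with
    | some j =>
      rw [Rat.heckeBeta_some_eq had j, _root_.mul_inv_rev, map_mul, map_inv,
        ← map_inv (Matrix.SpecialLinearGroup.mapGL ℚ), ← _root_.zpow_neg]
      refine mul_mem (inv_mem (Rat.globalToLocal_diagPrime_mem_localGammaOne hw _)) ?_
      rw [← GLn.localPart_ofGlobal]
      exact Rat.localPart_ofGlobal_mapGL_mem_localGammaOne (HeckeTGamma1.T_zpow_mem_Gamma1 N _) w
    | none =>
      rw [Rat.heckeBeta_none_inv_eq had, map_mul]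
      exact mul_mem (Rat.globalToLocal_mapGL_mul_scalarPrime_inv_mem_localGammaOne hw
          ⟨(bezoutDelta a b' d' N had)⁻¹, bezoutDelta_inv_mem_gamma0 a b' d' N had⟩ hγ)
        (Rat.globalToLocal_diagPrime_mem_localGammaOne hw _)

/-- The adelic representatives `ofLocal yⱼ` have trivial archimedean part. [folklore] -/
theorem Rat.archGL_ofLocal_heckeLocalRep (j : Option (Fin (natGenerator v))) :
    Rat.archGL 2 (GLn.ofLocal 2 ℚ v
      (heckeLocalRep (Rat.localUniformizer v : v.adicCompletion ℚ)
        (fun i : Fin (natGenerator v) => algebraMap ℚ (v.adicCompletion ℚ) ((i : ℕ) : ℚ))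
        (Rat.localUniformizer v).ne_zero j)) = 1 :=
  Rat.archGL_ofLocal v _

/-- **The `p + 1` adelic representatives form a transversal of `U diag(ϖ,1)_v U / U`** for both
levels `U = K(N)` and `U = {1} × K₁(N)`, `v = p ∤ N` (`bijOn_ofLocal_heckeLocalRep` of
`NewformAdelisationHeckeLocal` with the residue system `0, …, p-1` of `ℤ_p`; Gelbart (1975),
proof of Lemma 3.7: `H_p = ⊔ (p -b; 0 1) K_p ⊔ (1 0; 0 p) K_p`; Bump (1997), (6.7)).
[cite: Gelbart1975, Lemma 3.7 (proof)] -/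
theorem Rat.bijOn_range_ofLocal_heckeLocalRep {U : Subgroup (GL (Fin 2) (AdeleRing (𝓞 ℚ) ℚ))}
    (hU1 : (valuedCongruenceSubgroup (Fin 2) (1 : WithZero (Multiplicative ℤ))).map (GLn.ofLocal 2 ℚ v) ≤ U)
    (hU2 : ∀ u ∈ U, Matrix.GeneralLinearGroup.map (AdelicGroupData.adeleEval ℚ v) u ∈
      valuedCongruenceSubgroup (Fin 2) (1 : WithZero (Multiplicative ℤ)))
    (hU3 : ∀ u ∈ U, u * (GLn.ofLocal 2 ℚ v (Matrix.GeneralLinearGroup.map (AdelicGroupData.adeleEval ℚ v) u))⁻¹ ∈ U) :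
    Set.BijOn (fun y : GL (Fin 2) (AdeleRing (𝓞 ℚ) ℚ) => (y : GL (Fin 2) (AdeleRing (𝓞 ℚ) ℚ) ⧸ U))
      (Set.range fun j : Option (Fin (natGenerator v)) => GLn.ofLocal 2 ℚ v
        (heckeLocalRep (Rat.localUniformizer v : v.adicCompletion ℚ)
          (fun i : Fin (natGenerator v) => algebraMap ℚ (v.adicCompletion ℚ) ((i : ℕ) : ℚ))
          (Rat.localUniformizer v).ne_zero j))
      (MulAction.orbit U ((heckeDiagAt 2 ℚ v (Rat.localUniformizer v) 1 : GL (Fin 2) (AdeleRing (𝓞 ℚ) ℚ)) :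
        GL (Fin 2) (AdeleRing (𝓞 ℚ) ℚ) ⧸ U)) := by
  rw [heckeDiagAt_two_one_eq_ofLocal]
  exact bijOn_ofLocal_heckeLocalRep hU1 hU2 hU3 (Rat.localUniformizer v).ne_zero (Rat.valued_localUniformizer v)
    (fun i : Fin (natGenerator v) => algebraMap ℚ (v.adicCompletion ℚ) ((i : ℕ) : ℚ))
    (Rat.exists_valued_sub_algebraMap_natCast_lt_one v)
    (fun i j h => Rat.fin_eq_of_valued_sub_lt_one v h) (fun i => Rat.valued_algebraMap_natCast_le_one v i)

/-- The map `j ↦ ofLocal yⱼ` is injective (distinct cosets modulo `K(N)`). [folklore] -/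
theorem Rat.ofLocal_heckeLocalRep_injective [NeZero N] (hv : ¬ v.asIdeal ∣ Ideal.span {(N : 𝓞 ℚ)}) :
    Function.Injective fun j : Option (Fin (natGenerator v)) => GLn.ofLocal 2 ℚ v
      (heckeLocalRep (Rat.localUniformizer v : v.adicCompletion ℚ)
        (fun i : Fin (natGenerator v) => algebraMap ℚ (v.adicCompletion ℚ) ((i : ℕ) : ℚ))
        (Rat.localUniformizer v).ne_zero j) := by
  intro i j h
  beta_reduce at h
  obtain ⟨-, hU2, -⟩ := principalCongruenceLevel_local_hyps (n := 2) (Rat.span_natCast_ne_zero N) hv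
  exact ofLocal_heckeLocalRep_injOn hU2 (Rat.localUniformizer v).ne_zero (Rat.valued_localUniformizer v)
    (fun i : Fin (natGenerator v) => algebraMap ℚ (v.adicCompletion ℚ) ((i : ℕ) : ℚ))
    (fun i j h => Rat.fin_eq_of_valued_sub_lt_one v h) (by rw [h])

end Matching

/-! ### Gelbart's Lemma 3.7 pointwise: `∑ⱼ φ_f(h yⱼ) = p^{1-k/2} a_p φ_f(h)` and `φ_f(h t₂) = χ(p) φ_f(h)` -/

section Pointwise

variable {N : ℕ} [NeZero N] {k : ℤ} {f : CuspForm (Gamma1 N) k} {v : HeightOneSpectrum (𝓞 ℚ)}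

/-- **Lemma 3.7 at the archimedean points**: for a newform `f`, `p ∤ N` and `det g_∞ > 0`,
`∑ⱼ φ_f((g_∞, 1) yⱼ) = ∑ⱼ archLift k f (βⱼ⁻¹ g_∞) = (a_p / (√p)^{k-2}) φ_f((g_∞, 1))`
(`adelicLiftFun_ofRealGL_mul_eq_archLift` and `sum_archLift_heckeBeta_inv_mul`; Gelbart (1975),
proof of Lemma 3.7: `p^{k/2-1} T̃(p) φ(g) = p⁻¹ ∑_b f((z+b)/p) + p^{k-1} f(pz) = φ_{T(p)f}(g)`).
[cite: Gelbart1975, Lemma 3.7] -/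
theorem sum_adelicLiftFun_ofRealGL_mul_eq (hB : IsNewform1.mem_nebentypusSubspace_nebentypus (N := N) (k := k))
    (hf : IsNewform1 f) (hv : ¬ v.asIdeal ∣ Ideal.span {(N : 𝓞 ℚ)})
    {a b' d' : ℤ} (had : a * d' - b' * N = 1) (hap : (N : ℤ) ∣ a - natGenerator v)
    {g : GL (Fin 2) ℝ} (hg : 0 < g.det.val) :
    ∑ j : Option (Fin (natGenerator v)), adelicLiftFun N k f (Rat.ofRealGL 2 g * GLn.ofLocal 2 ℚ v
      (heckeLocalRep (Rat.localUniformizer v : v.adicCompletion ℚ)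
        (fun i : Fin (natGenerator v) => algebraMap ℚ (v.adicCompletion ℚ) ((i : ℕ) : ℚ))
        (Rat.localUniformizer v).ne_zero j)) =
      (heckeEigenvalue f (natGenerator v) / (((Real.sqrt (natGenerator v) : ℝ) : ℂ) ^ (k - 2))) *
        adelicLiftFun N k f (Rat.ofRealGL 2 g) := by
  have hpN : ¬ natGenerator v ∣ N := fun h => hv ((Rat.natGenerator_dvd_iff v N).1 h)
  have hterm : ∀ j : Option (Fin (natGenerator v)), adelicLiftFun N k f (Rat.ofRealGL 2 g * GLn.ofLocal 2 ℚ v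
      (heckeLocalRep (Rat.localUniformizer v : v.adicCompletion ℚ)
        (fun i : Fin (natGenerator v) => algebraMap ℚ (v.adicCompletion ℚ) ((i : ℕ) : ℚ))
        (Rat.localUniformizer v).ne_zero j)) =
      archLift k f ((Matrix.GeneralLinearGroup.map (Rat.castHom ℝ)
        (heckeBeta (natGenerator v) a b' d' N (prime_natGenerator v).ne_zero had j))⁻¹ * g) := fun j =>
    adelicLiftFun_ofRealGL_mul_eq_archLift f hg
      (by rw [val_det_heckeBeta]; exact_mod_cast (prime_natGenerator v).pos)
      (Rat.archGL_ofLocal_heckeLocalRep j)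
      (Rat.globalToLocal_heckeBeta_inv_mul_mem_localGammaOne hv had hap j)
  simp_rw [hterm]
  rw [sum_archLift_heckeBeta_inv_mul (natGenerator v) (prime_natGenerator v) a b' d' had hap hB hpN hf hg,
    adelicLiftFun_ofRealGL f hg]

/-- **Gelbart's Lemma 3.7, pointwise on `GL₂(𝔸_ℚ)`**: for a newform `f ∈ S_k(Γ₁(N))`,
`v = p ∤ N` and every `h ∈ GL₂(𝔸_ℚ)`,
`∑ⱼ φ_f(h yⱼ) = (a_p / (√p)^{k-2}) φ_f(h)`, the `yⱼ` running over the representatives of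
`K_p diag(p,1) K_p / K_p` placed at `v` (i.e. `p^{k/2-1} T̃(p) φ_f = φ_{T(p) f} = a_p φ_f`):
write `h = γ (g_∞, 1) u` (`Rat.exists_ofGlobal_inv_mul_mem_plusLevelOne`,
`Rat.ofRealGL_archGL_inv_mul_mem_gammaOneLevel`), drop `γ` by left invariance, move `u` through
the `yⱼ` (it permutes the cosets `yⱼ ({1} × K₁(N))`, `sum_apply_mul_mul_eq_of_bijOn_cosets`) and
drop it by right invariance, and conclude by `sum_adelicLiftFun_ofRealGL_mul_eq`.
[cite: Gelbart1975, Lemma 3.7] [cite: Bump1997, §3.6, p. 342] -/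
theorem sum_adelicLiftFun_mul_eq (hB : IsNewform1.mem_nebentypusSubspace_nebentypus (N := N) (k := k))
    (hf : IsNewform1 f) (hv : ¬ v.asIdeal ∣ Ideal.span {(N : 𝓞 ℚ)}) (h : GL (Fin 2) (AdeleRing (𝓞 ℚ) ℚ)) :
    ∑ j : Option (Fin (natGenerator v)), adelicLiftFun N k f (h * GLn.ofLocal 2 ℚ v
      (heckeLocalRep (Rat.localUniformizer v : v.adicCompletion ℚ)
        (fun i : Fin (natGenerator v) => algebraMap ℚ (v.adicCompletion ℚ) ((i : ℕ) : ℚ))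
        (Rat.localUniformizer v).ne_zero j)) =
      (heckeEigenvalue f (natGenerator v) / (((Real.sqrt (natGenerator v) : ℝ) : ℂ) ^ (k - 2))) *
        adelicLiftFun N k f h := by
  have h𝔫 : Ideal.span {(N : 𝓞 ℚ)} ≠ 0 := Rat.span_natCast_ne_zero N
  have hpN : ¬ natGenerator v ∣ N := fun h => hv ((Rat.natGenerator_dvd_iff v N).1 h)
  obtain ⟨a, b', d', had, hap⟩ := exists_bezout_level N (natGenerator v) (prime_natGenerator v) hpN
  -- `h = γ h₀`, `h₀ ∈ GL₂(ℝ)⁺ × K₁(N)`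
  obtain ⟨γ, hγ⟩ := Rat.exists_ofGlobal_inv_mul_mem_plusLevelOne (Ideal.span {(N : 𝓞 ℚ)}) h
  set h₀ : GL (Fin 2) (AdeleRing (𝓞 ℚ) ℚ) := (GLn.ofGlobal 2 ℚ γ)⁻¹ * h with hh₀
  have hh : h = GLn.ofGlobal 2 ℚ γ * h₀ := by rw [hh₀, mul_inv_cancel_left]
  have hred : ∀ z, adelicLiftFun N k f (h * z) = adelicLiftFun N k f (h₀ * z) := fun z => by
    rw [hh, mul_assoc, adelicLiftFun_ofGlobal_mul]
  have hred₀ : adelicLiftFun N k f h = adelicLiftFun N k f h₀ := by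
    simpa only [mul_one] using hred 1
  simp_rw [hred]
  rw [hred₀]
  -- `h₀ = (g_∞, 1) u`, `u ∈ {1} × K₁(N)`
  have hdet : 0 < (Rat.archGL 2 h₀).det.val := (Rat.mem_plusLevelOne_iff.1 hγ).1
  set g : GL (Fin 2) ℝ := Rat.archGL 2 h₀
  set u : GL (Fin 2) (AdeleRing (𝓞 ℚ) ℚ) := (Rat.ofRealGL 2 g)⁻¹ * h₀ with hudef
  have hu : u ∈ gammaOneLevel ℚ (Ideal.span {(N : 𝓞 ℚ)}) := Rat.ofRealGL_archGL_inv_mul_mem_gammaOneLevel hγ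
  have hh₀' : h₀ = Rat.ofRealGL 2 g * u := by rw [hudef, mul_inv_cancel_left]
  -- the level `{1} × K₁(N)` at `v`
  obtain ⟨hU1, hU2, hU3⟩ := gammaOneLevel_local_hyps (K := ℚ) (v := v) h𝔫 hv
  rw [hh₀']
  simp_rw [mul_assoc]
  rw [sum_apply_mul_mul_eq_of_bijOn_cosets _ _ (Rat.bijOn_range_ofLocal_heckeLocalRep hU1 hU2 hU3)
      (Rat.ofLocal_heckeLocalRep_injective hv) (adelicLiftFun N k f)
      (fun x z hz => adelicLiftFun_mul_of_mem_gammaOneLevel f x hz) hu,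
    adelicLiftFun_mul_of_mem_gammaOneLevel f _ hu]
  exact sum_adelicLiftFun_ofRealGL_mul_eq hB hf hv had hap hdet

/-- The real image of `p · 1 ∈ GL₂(ℚ)` is the scalar matrix `realScalarGL p`. [folklore] -/
theorem Rat.map_castHom_scalarPrime (v : HeightOneSpectrum (𝓞 ℚ)) :
    Matrix.GeneralLinearGroup.map (Rat.castHom ℝ) (Rat.scalarPrime v) =
      realScalarGL (natGenerator v : ℝ) (Nat.cast_pos.mpr (prime_natGenerator v).pos) := by
  refine Matrix.GeneralLinearGroup.ext fun i l => ?_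
  rw [Matrix.GeneralLinearGroup.map_apply, Rat.coe_scalarPrime, realScalarGL_apply, Matrix.smul_apply,
    Matrix.one_apply, smul_eq_mul, mul_ite, mul_one, mul_zero]
  split_ifs <;> simp

/-- **`ℝ_p φ_f = χ(p) φ_f` pointwise** (Bump (1997), §3.6, (6.4) and p. 342; Gelbart (1975),
Prop. 3.1 (v)): for a newform `f ∈ S_k(Γ₁(N))` of nebentypus `χ`, `v = p ∤ N` and every
`h ∈ GL₂(𝔸_ℚ)`, `φ_f(h · diag(ϖ,ϖ)_v) = χ(p) φ_f(h)`. Proof: `diag(ϖ,ϖ)_v = ι_v(p·1)` is central,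
so after `h = γ (g_∞,1) u` it remains to evaluate `φ_f((g_∞,1) ι_v(p·1))`; with the rational
matrix `β = δ (p·1)`, `δ = (a b'; N d')`, `a ≡ p (N)`, one has `β⁻¹ ι_v(p·1) = δ⁻¹` at `v`,
`β⁻¹ = δ⁻¹ (p·1)⁻¹ ∈ K₁(N)_w` at `w ≠ v`, hence the value `archLift k f (p⁻¹ δ⁻¹ g_∞) =
archLift k f (δ⁻¹ g_∞) = χ(a) archLift k f (g_∞)` (`f ∣ δ⁻¹ = χ(a) f`, `δ⁻¹ ∈ Γ₀(N)` with lower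
right entry `a`). [cite: Bump1997, §3.6, (6.4) and p. 342] -/
theorem adelicLiftFun_mul_heckeDiagAt_two (hB : IsNewform1.mem_nebentypusSubspace_nebentypus (N := N) (k := k))
    (hf : IsNewform1 f) (hv : ¬ v.asIdeal ∣ Ideal.span {(N : 𝓞 ℚ)}) (h : GL (Fin 2) (AdeleRing (𝓞 ℚ) ℚ)) :
    adelicLiftFun N k f (h * heckeDiagAt 2 ℚ v (Rat.localUniformizer v) 2) =
      nebentypus f ((natGenerator v : ℕ) : ZMod N) * adelicLiftFun N k f h := by
  have h𝔫 : Ideal.span {(N : 𝓞 ℚ)} ≠ 0 := Rat.span_natCast_ne_zero N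
  have hp := prime_natGenerator v
  have hp0 : (0 : ℝ) < natGenerator v := Nat.cast_pos.mpr hp.pos
  have hpN : ¬ natGenerator v ∣ N := fun h => hv ((Rat.natGenerator_dvd_iff v N).1 h)
  obtain ⟨a, b', d', had, hap⟩ := exists_bezout_level N (natGenerator v) hp hpN
  set t₂ : GL (Fin 2) (AdeleRing (𝓞 ℚ) ℚ) := heckeDiagAt 2 ℚ v (Rat.localUniformizer v) 2 with ht₂
  have ht₂c : t₂ ∈ Subgroup.center (GL (Fin 2) (AdeleRing (𝓞 ℚ) ℚ)) :=
    heckeDiagAt_self_mem_center (n := 2) v (Rat.localUniformizer v)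
  -- `h = γ h₀`, `h₀ = (g_∞, 1) u`
  obtain ⟨γ, hγ⟩ := Rat.exists_ofGlobal_inv_mul_mem_plusLevelOne (Ideal.span {(N : 𝓞 ℚ)}) h
  set h₀ : GL (Fin 2) (AdeleRing (𝓞 ℚ) ℚ) := (GLn.ofGlobal 2 ℚ γ)⁻¹ * h with hh₀
  have hh : h = GLn.ofGlobal 2 ℚ γ * h₀ := by rw [hh₀, mul_inv_cancel_left]
  have hdet : 0 < (Rat.archGL 2 h₀).det.val := (Rat.mem_plusLevelOne_iff.1 hγ).1
  set g : GL (Fin 2) ℝ := Rat.archGL 2 h₀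
  set u : GL (Fin 2) (AdeleRing (𝓞 ℚ) ℚ) := (Rat.ofRealGL 2 g)⁻¹ * h₀ with hudef
  have hu : u ∈ gammaOneLevel ℚ (Ideal.span {(N : 𝓞 ℚ)}) := Rat.ofRealGL_archGL_inv_mul_mem_gammaOneLevel hγ
  have hh₀' : h₀ = Rat.ofRealGL 2 g * u := by rw [hudef, mul_inv_cancel_left]
  have hL : adelicLiftFun N k f (h * t₂) = adelicLiftFun N k f (Rat.ofRealGL 2 g * t₂) := by
    rw [hh, mul_assoc, adelicLiftFun_ofGlobal_mul, hh₀', mul_assoc, Subgroup.mem_center_iff.1 ht₂c u,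
      ← mul_assoc, adelicLiftFun_mul_of_mem_gammaOneLevel f _ hu]
  have hR : adelicLiftFun N k f h = archLift k f g := by
    rw [hh, adelicLiftFun_ofGlobal_mul, hh₀', adelicLiftFun_mul_of_mem_gammaOneLevel f _ hu,
      adelicLiftFun_ofRealGL f hdet]
  rw [hL, hR]
  -- the rational matrix `β = δ (p·1)` and the matching at the finite places
  set δ : SL(2, ℤ) := bezoutDelta a b' d' N had with hδ
  set β : GL (Fin 2) ℚ := Matrix.SpecialLinearGroup.mapGL ℚ δ * Rat.scalarPrime v with hβ
  have hβinv : β⁻¹ = Matrix.SpecialLinearGroup.mapGL ℚ δ⁻¹ * (Rat.scalarPrime v)⁻¹ := by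
    rw [hβ, ← Rat.scalarPrime_mul_comm, _root_.mul_inv_rev, map_inv]
  have hγ0 : CongruenceSubgroup.Gamma0Map N ⟨δ⁻¹, bezoutDelta_inv_mem_gamma0 a b' d' N had⟩ =
      ((natGenerator v : ℕ) : ZMod N) := by
    change ((((δ⁻¹ : SL(2, ℤ)) : Matrix (Fin 2) (Fin 2) ℤ) 1 1 : ℤ) : ZMod N) = _
    rw [hδ, bezoutDelta_inv_apply_one_one, ← Int.cast_natCast]
    exact ((ZMod.intCast_eq_intCast_iff_dvd_sub (natGenerator v : ℤ) a N).2 hap).symm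
  have hβdet : 0 < (β.det : ℚ) := by
    rw [hβ, map_mul, Units.val_mul]
    refine mul_pos ?_ ?_
    · have : (Matrix.SpecialLinearGroup.mapGL ℚ δ).det.val = 1 := by
        rw [Matrix.GeneralLinearGroup.val_det_apply]
        exact Matrix.SpecialLinearGroup.det_coe _
      rw [this]; exact one_pos
    · rw [Matrix.GeneralLinearGroup.val_det_apply, Rat.coe_scalarPrime, Matrix.det_smul, Matrix.det_one,
        mul_one, Fintype.card_fin]
      exact pow_pos (Nat.cast_pos.mpr hp.pos) 2
  have hty : Rat.archGL 2 t₂ = 1 := by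
    rw [ht₂, Rat.heckeDiagAt_localUniformizer_two, Rat.archGL_ofLocal]
  have hβy : ∀ w : HeightOneSpectrum (𝓞 ℚ),
      Rat.globalToLocal 2 w β⁻¹ * GLn.localPart 2 ℚ w t₂ ∈ Rat.localGammaOne w (Ideal.span {(N : 𝓞 ℚ)}) := by
    intro w
    rw [hβinv, ht₂, Rat.heckeDiagAt_localUniformizer_two]
    by_cases hw : w = v
    · subst hw
      rw [GLn.localPart_ofLocal, map_mul, map_inv (Rat.globalToLocal 2 _) (Rat.scalarPrime _),
        inv_mul_cancel_right]
      exact Rat.valuedCongruenceSubgroup_one_le_localGammaOne h𝔫 hv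
        (Rat.globalToLocal_mapGL_mem_valuedCongruenceSubgroup_one _)
    · rw [GLn.localPart_ofLocal_of_ne hw, mul_one]
      exact Rat.globalToLocal_mapGL_mul_scalarPrime_inv_mem_localGammaOne hw
        ⟨δ⁻¹, bezoutDelta_inv_mem_gamma0 a b' d' N had⟩ hγ0
  rw [adelicLiftFun_ofRealGL_mul_eq_archLift f hdet hβdet hty hβy]
  -- the archimedean value `archLift k f ((p·1)⁻¹ δ⁻¹ g) = χ(a) archLift k f g`
  have hreal : (Matrix.GeneralLinearGroup.map (Rat.castHom ℝ) β)⁻¹ * g =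
      (realScalarGL (natGenerator v : ℝ) hp0)⁻¹ * (Matrix.SpecialLinearGroup.mapGL ℝ δ⁻¹ * g) := by
    rw [hβ, map_mul, Rat.map_castHom_mapGL, Rat.map_castHom_scalarPrime, _root_.mul_inv_rev, map_inv, mul_assoc]
  have hδdet : (Matrix.SpecialLinearGroup.mapGL ℝ δ⁻¹).det.val = 1 := by
    rw [Matrix.GeneralLinearGroup.val_det_apply]
    exact Matrix.SpecialLinearGroup.det_coe _
  have hXdet : 0 < (Matrix.SpecialLinearGroup.mapGL ℝ δ⁻¹ * g).det.val := by
    rw [map_mul, Units.val_mul, hδdet, one_mul]; exact hdet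
  have hscal : archLift k f ((realScalarGL (natGenerator v : ℝ) hp0)⁻¹ * (Matrix.SpecialLinearGroup.mapGL ℝ δ⁻¹ * g)) =
      archLift k f (Matrix.SpecialLinearGroup.mapGL ℝ δ⁻¹ * g) := by
    have hX'det : 0 < ((realScalarGL (natGenerator v : ℝ) hp0)⁻¹ *
        (Matrix.SpecialLinearGroup.mapGL ℝ δ⁻¹ * g)).det.val := by
      rw [map_mul, map_inv, Units.val_mul, Units.val_inv_eq_inv_val, det_realScalarGL]
      exact mul_pos (inv_pos.2 (pow_pos hp0 2)) hXdet
    have e := archLift_realScalarGL_mul k (⇑f) hp0 hX'det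
    rw [mul_inv_cancel_left] at e
    exact e.symm
  rw [hreal, hscal, archLift_apply, archLift_apply, SlashAction.slash_mul, map_mul, Units.val_mul, hδdet, one_mul]
  have e : Matrix.SpecialLinearGroup.mapGL ℝ δ⁻¹ = ((δ⁻¹ : SL(2, ℤ)) : GL (Fin 2) ℝ) := rfl
  have hχ : nebentypus f ((a : ℤ) : ZMod N) = nebentypus f ((natGenerator v : ℕ) : ZMod N) := by
    congr 1
    rw [← Int.cast_natCast]
    exact ((ZMod.intCast_eq_intCast_iff_dvd_sub (natGenerator v : ℤ) a N).2 hap).symm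
  rw [e, hδ, slash_eq_nebentypus_smul_of_mem_gamma0 hB hf (bezoutDelta_inv_mem_gamma0 a b' d' N had),
    bezoutDelta_inv_apply_one_one, hχ, ModularForm.smul_slash, UpperHalfPlane.σ, if_pos hdet, Pi.smul_apply,
    smul_eq_mul, mul_assoc]
  rfl

end Pointwise

/-! ### The discharge of `adelicLift_heckeEigenvalues` -/

section Discharge

/-- **Hecke eigenvalues of the adelic lift of a newform, granted `f ∈ S_k(N, χ)`** (Gelbart
(1975), Lemma 3.7; Bump (1997), §3.6, p. 342): the named fact `adelicLift_heckeEigenvalues` of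
`NewformAdelisationLift` under the nebentypus fact `IsNewform1.mem_nebentypusSubspace_nebentypus`
(for all levels and weights). With `ϖ = p` (`Rat.localUniformizer`): `T_{p,1} [φ_f]` is the sum of
the `p + 1` translates `R(yⱼ) [φ_f]` (`heckeOperatorAt_toLp_eq_smul_of_sum_eq`,
`Rat.bijOn_range_ofLocal_heckeLocalRep`), computed pointwise by `sum_adelicLiftFun_mul_eq`; `T_{p,2} [φ_f]`
is `R(diag(ϖ,ϖ)_v) [φ_f]` (central), computed pointwise by `adelicLiftFun_mul_heckeDiagAt_two`.
[cite: Gelbart1975, Lemma 3.7] [cite: Bump1997, §3.6, (6.4) and p. 342] -/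
theorem adelicLift_heckeEigenvalues_of_mem_nebentypusSubspace
    (hB : ∀ (N : ℕ) [NeZero N] (k : ℤ), IsNewform1.mem_nebentypusSubspace_nebentypus (N := N) (k := k)) :
    adelicLift_heckeEigenvalues := by
  intro N _ k f hf μ _ W hW v hv
  classical
  have h𝔫 : Ideal.span {(N : 𝓞 ℚ)} ≠ 0 := Rat.span_natCast_ne_zero N
  have hfix := toLp_adelicLift_mem_fixedVectors f μ W hW
  refine ⟨Rat.localUniformizer v, Rat.valued_localUniformizer v, ?_, ?_⟩
  · -- `T_{p,1}`: the transversal and the pointwise identity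
    obtain ⟨hU1, hU2, hU3⟩ := principalCongruenceLevel_local_hyps (n := 2) (K := ℚ) (v := v) h𝔫 hv
    set y : Option (Fin (natGenerator v)) → GL (Fin 2) (AdeleRing (𝓞 ℚ) ℚ) := fun j => GLn.ofLocal 2 ℚ v
      (heckeLocalRep (Rat.localUniformizer v : v.adicCompletion ℚ)
        (fun i : Fin (natGenerator v) => algebraMap ℚ (v.adicCompletion ℚ) ((i : ℕ) : ℚ))
        (Rat.localUniformizer v).ne_zero j)
    have hinj : Function.Injective y := Rat.ofLocal_heckeLocalRep_injective hv
    refine heckeOperatorAt_toLp_eq_smul_of_sum_eq W (memLp_adelicLift f μ 2) hW _ _ (y := y) hinj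
      (Rat.bijOn_range_ofLocal_heckeLocalRep hU1 hU2 hU3) hfix _ fun x => ?_
    obtain ⟨x, rfl⟩ : ∃ g : GL (Fin 2) (AdeleRing (𝓞 ℚ) ℚ), (AdelicGroupData.gl 2 ℚ).toAutomorphicQuotient g = x :=
      QuotientGroup.mk_surjective x
    change ∑ j, adelicLiftFun N k f ((y j)⁻¹ * x)⁻¹ = _ * adelicLiftFun N k f x⁻¹
    simp_rw [_root_.mul_inv_rev, inv_inv]
    exact sum_adelicLiftFun_mul_eq (hB N k) hf hv _
  · -- `T_{p,2}`: central
    refine heckeOperatorAt_toLp_eq_smul_of_mem_center W (memLp_adelicLift f μ 2) hW _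
      (heckeDiagAt_self_mem_center (n := 2) v (Rat.localUniformizer v)) hfix _ fun x => ?_
    obtain ⟨x, rfl⟩ : ∃ g : GL (Fin 2) (AdeleRing (𝓞 ℚ) ℚ), (AdelicGroupData.gl 2 ℚ).toAutomorphicQuotient g = x :=
      QuotientGroup.mk_surjective x
    change adelicLiftFun N k f ((heckeDiagAt 2 ℚ v (Rat.localUniformizer v) 2)⁻¹ * x)⁻¹ = _ * adelicLiftFun N k f x⁻¹
    rw [_root_.mul_inv_rev, inv_inv]
    exact adelicLiftFun_mul_heckeDiagAt_two (hB N k) hf hv _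

/-- **Discharge of `adelicLift_heckeEigenvalues`** (Gelbart (1975), Lemma 3.7; Bump (1997),
§3.6, p. 342): the Hecke eigenvalues of the adelic lift of a newform, unconditionally — the
nebentypus fact is `IsNewform1.mem_nebentypusSubspace_nebentypus_holds` of
`LanglandsTunnellLSeriesProofs`. [cite: Gelbart1975, Lemma 3.7] -/
theorem adelicLift_heckeEigenvalues_holds : adelicLift_heckeEigenvalues :=
  adelicLift_heckeEigenvalues_of_mem_nebentypusSubspace fun _ _ _ =>
    IsNewform1.mem_nebentypusSubspace_nebentypus_holds

end Discharge

end Literature.NumberTheory.Automorphic
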